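import Summits.HubbardSuperconductivity.HubbardLadder.PairCorrWindowOfOpBounds
import Summits.Ventures.CertifiedManyBodySolver.Rows.TorusPairDiagDominance
import Summits.Ventures.CertifiedManyBodySolver.Rows.TorusPairSumRule
import HarnessLib

/-!
# Finite torus: ONE certified diagonal pair CEILING `Re ⟨ψ, O_0 ψ⟩ ≤ χ` is a full table — `[0, χ/L²]` at `r = 0` and `[-χ/L², χ/L²]` at every displacement

HONEST FRAMING: first certified bounds; not a superconductivity verdict; every number certified or labelled float.
Speedrun `mbsolver`, seat sr-mbsolver-m3-5 (R-M3-2 row owner of the `pair_dd` rows), gen 4.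
Theorem-only; no claim node, no named fact; zero compute.

The point.  The speedrun's S3 certificate is ONE-SIDED: an SDP UPPER bound `Re ⟨ψ, O_0 ψ⟩ ≤ χ` on the pair
correlator word `O_0 = Σ_x Δ_x† Δ_x = pairCorrOp L 0` over the normalised `(N L, S^z = 0)` sector ground states
of `H L` (so `P̄_d(L, 0; ψ) = avgPairCorr L 0 ψ ≤ χ/L²`, `avgPairCorr_eq_re_expect_pairCorrOp`).  The tree's row
constructor `PairCorrWindowCert.ofPairCorrOpBounds` wants BOTH sides.  At `r = 0` the lower side is free —
`Re ⟨ψ, O_0 ψ⟩ = Σ_x ‖Δ_x ψ‖² ≥ 0` for EVERY vector (`re_expect_pairCorrOp_zero_nonneg`, from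
`avgPairCorr_zero_nonneg` of `Rows/TorusPairDiagDominance.lean`) — so one upper number gives the diagonal row
`[0, χ/L²]` (`exists_pairCorrWindowCert_diag_of_upper`, `avgPairCorr_zero_mem_Icc_of_upper`), and by the every-state
dominance `|P̄_d(L, r; ψ)| ≤ P̄_d(L, 0; ψ)` (`abs_avgPairCorr_le_avgPairCorr_zero`) the row `[-χ/L², χ/L²]` at EVERY
displacement `r` (`avgPairCorr_mem_Icc_of_diag_upper`, `exists_pairCorrWindowCert_all_of_diag_upper`).  This is the
exact Lean shape of the cell's S3 words: one certified `u₀₀ = χ/16` at `4 × 4`, `N = 14` boxes the sixteen `P̄_d(r)`;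
rows at the same `(H, N, L, r)` intersect (`exists_pairCorrWindowCert_inter`, the registry's 'tightest of record').
§2: the `S_d` word — `Σ_{r ∈ halfOpenBox 2 L} O_r = Δ_d† Δ_d` as OPERATORS (`sum_halfOpenBox_pairCorrOp`), so a
certified `S_d`-type ceiling `Re ⟨ψ, Δ_d† Δ_d ψ⟩ ≤ S` is a `pairFieldDensity` ceiling `S/L⁴` and a ceiling `S/L²` on
`Σ_r P̄_d(L, r; ψ)` (`pairFieldDensity_le_of_pairField_upper`; the cell's S2b rows).
HONEST LABEL: kinematic transfer of one certified number; 'non-trivial' only relative to sr-mbsolver-m3-2's certified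
kinematic ranges (the cell files grade it); no number lives in this file.
References: M. Qin et al., Phys. Rev. X 10, 031016 (2020), §II eqs. (2)–(4); D. J. Scalapino, Phys. Rep. 250 (1995)
329, §2; Wang et al., PRX 2024 §3 eq. (4) (observable windows). Folklore otherwise.
-/

namespace Summit.Ventures.CertifiedManyBodySolver.TorusPair

open Matrix Finset Literature.Probability.LatticeModels Literature.MathematicalPhysics.QuantumLattice
  Summit.HubbardSuperconductivity.HubbardLadder
open scoped ComplexOrder

noncomputable section

variable {H : TorusHamiltonianFamily} {N : ℕ → ℕ}

/-- **The lower side at `r = 0` is free:** `0 ≤ Re ⟨ψ, O_0 ψ⟩` for every vector `ψ` of the `(m+1) × (m+1)`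
torus (`O_0 = Σ_x Δ_x† Δ_x`). Scalapino (1995) §2. [folklore] -/
theorem re_expect_pairCorrOp_zero_nonneg (m : ℕ) (ψ : Fock (Orb (FermionTorus 2 (m + 1)))) :
    0 ≤ (star ψ ⬝ᵥ pairCorrOp (m + 1) 0 *ᵥ ψ).re := by
  have h := avgPairCorr_zero_nonneg (m + 1) ψ
  rw [avgPairCorr_eq_re_expect_pairCorrOp m 0 ψ] at h
  have hL : (0 : ℝ) < ((m + 1 : ℕ) : ℝ) ^ 2 := by positivity
  exact (div_nonneg_iff.mp h).elim (fun h' => h'.1) fun h' => absurd h'.2 (not_le.mpr hL)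

/-- **One certified ceiling ⇒ the diagonal row `[0, χ/(m+1)²]`.** [cite: QinEtAl2020, §II eqs. (2)–(4)] -/
theorem exists_pairCorrWindowCert_diag_of_upper (m : ℕ) (chi : ℝ)
    (hhi : ∀ ψ : Fock (Orb (FermionTorus 2 (m + 1))), star ψ ⬝ᵥ ψ = 1 →
      IsGroundStateInSector (H (m + 1)) (N (m + 1)) 0 ψ →
        (star ψ ⬝ᵥ pairCorrOp (m + 1) 0 *ᵥ ψ).re ≤ chi) :
    ∃ c : PairCorrWindowCert H N (m + 1) 0, c.lo = 0 ∧ c.hi = chi / ((m + 1 : ℕ) : ℝ) ^ 2 := by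
  refine ⟨PairCorrWindowCert.ofPairCorrOpBounds (H := H) (N := N) m 0 0 chi
    (fun ψ _ _ => re_expect_pairCorrOp_zero_nonneg m ψ) hhi, ?_, ?_⟩
  · exact ((PairCorrWindowCert.ofPairCorrOpBounds_lo_hi (H := H) (N := N) m 0 0 chi
      (fun ψ _ _ => re_expect_pairCorrOp_zero_nonneg m ψ) hhi).1).trans (zero_div _)
  · exact (PairCorrWindowCert.ofPairCorrOpBounds_lo_hi (H := H) (N := N) m 0 0 chi
      (fun ψ _ _ => re_expect_pairCorrOp_zero_nonneg m ψ) hhi).2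

/-- **The diagonal window read on `avgPairCorr`:** `0 ≤ P̄_d(m+1, 0; ψ) ≤ χ/(m+1)²` on every normalised sector
ground state. [cite: QinEtAl2020, §II eqs. (2)–(4)] -/
theorem avgPairCorr_zero_mem_Icc_of_upper (m : ℕ) (chi : ℝ)
    (hhi : ∀ ψ : Fock (Orb (FermionTorus 2 (m + 1))), star ψ ⬝ᵥ ψ = 1 →
      IsGroundStateInSector (H (m + 1)) (N (m + 1)) 0 ψ →
        (star ψ ⬝ᵥ pairCorrOp (m + 1) 0 *ᵥ ψ).re ≤ chi)
    (ψ : Fock (Orb (FermionTorus 2 (m + 1)))) (h1 : star ψ ⬝ᵥ ψ = 1)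
    (hgs : IsGroundStateInSector (H (m + 1)) (N (m + 1)) 0 ψ) :
    avgPairCorr (m + 1) 0 ψ ∈ Set.Icc 0 (chi / ((m + 1 : ℕ) : ℝ) ^ 2) := by
  have h := avgPairCorr_mem_window_of_pairCorrOpBounds (H := H) (N := N) m 0 0 chi
    (fun ψ _ _ => re_expect_pairCorrOp_zero_nonneg m ψ) hhi ψ h1 hgs
  exact ⟨(zero_div _).symm.le.trans h.1, h.2⟩

/-- **One certified diagonal ceiling boxes EVERY displacement:** `|P̄_d(m+1, r; ψ)| ≤ χ/(m+1)²`, i.e.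
`P̄_d(m+1, r; ψ) ∈ [-χ/(m+1)², χ/(m+1)²]`, on every normalised sector ground state, for every `r`.
HONEST FRAMING: first certified bounds; not a superconductivity verdict; every number certified or labelled float.
[cite: QinEtAl2020, §II eqs. (2)–(4)] -/
theorem avgPairCorr_mem_Icc_of_diag_upper (m : ℕ) (chi : ℝ)
    (hhi : ∀ ψ : Fock (Orb (FermionTorus 2 (m + 1))), star ψ ⬝ᵥ ψ = 1 →
      IsGroundStateInSector (H (m + 1)) (N (m + 1)) 0 ψ →
        (star ψ ⬝ᵥ pairCorrOp (m + 1) 0 *ᵥ ψ).re ≤ chi)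
    (r : Site 2) (ψ : Fock (Orb (FermionTorus 2 (m + 1)))) (h1 : star ψ ⬝ᵥ ψ = 1)
    (hgs : IsGroundStateInSector (H (m + 1)) (N (m + 1)) 0 ψ) :
    avgPairCorr (m + 1) r ψ ∈ Set.Icc (-(chi / ((m + 1 : ℕ) : ℝ) ^ 2)) (chi / ((m + 1 : ℕ) : ℝ) ^ 2) := by
  have h0 := (avgPairCorr_zero_mem_Icc_of_upper (H := H) (N := N) m chi hhi ψ h1 hgs).2
  have hd := abs_avgPairCorr_le_avgPairCorr_zero (m + 1) r ψ
  constructor <;> [linarith [neg_abs_le (avgPairCorr (m + 1) r ψ)];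
    linarith [le_abs_self (avgPairCorr (m + 1) r ψ)]]

/-- **The full table from one number:** for every displacement `r` a `PairCorrWindowCert` row
`[-χ/(m+1)², χ/(m+1)²]`. [cite: QinEtAl2020, §II eqs. (2)–(4)] -/
theorem exists_pairCorrWindowCert_all_of_diag_upper (m : ℕ) (chi : ℝ)
    (hhi : ∀ ψ : Fock (Orb (FermionTorus 2 (m + 1))), star ψ ⬝ᵥ ψ = 1 →
      IsGroundStateInSector (H (m + 1)) (N (m + 1)) 0 ψ →
        (star ψ ⬝ᵥ pairCorrOp (m + 1) 0 *ᵥ ψ).re ≤ chi) (r : Site 2) :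
    ∃ c : PairCorrWindowCert H N (m + 1) r,
      c.lo = -(chi / ((m + 1 : ℕ) : ℝ) ^ 2) ∧ c.hi = chi / ((m + 1 : ℕ) : ℝ) ^ 2 :=
  ⟨⟨-(chi / ((m + 1 : ℕ) : ℝ) ^ 2), chi / ((m + 1 : ℕ) : ℝ) ^ 2, fun ψ h1 hgs =>
    avgPairCorr_mem_Icc_of_diag_upper (H := H) (N := N) m chi hhi r ψ h1 hgs⟩, rfl, rfl⟩

/-- **A certified ceiling is non-negative** (the sector is assumed inhabited by a normalised ground state, as
for the Hubbard tori): `0 ≤ χ`. [folklore] -/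
theorem diag_upper_nonneg (m : ℕ) (chi : ℝ)
    (hhi : ∀ ψ : Fock (Orb (FermionTorus 2 (m + 1))), star ψ ⬝ᵥ ψ = 1 →
      IsGroundStateInSector (H (m + 1)) (N (m + 1)) 0 ψ →
        (star ψ ⬝ᵥ pairCorrOp (m + 1) 0 *ᵥ ψ).re ≤ chi)
    (hex : ∃ ψ : Fock (Orb (FermionTorus 2 (m + 1))), star ψ ⬝ᵥ ψ = 1 ∧
      IsGroundStateInSector (H (m + 1)) (N (m + 1)) 0 ψ) : 0 ≤ chi := by
  obtain ⟨ψ, h1, hgs⟩ := hex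
  exact (re_expect_pairCorrOp_zero_nonneg m ψ).trans (hhi ψ h1 hgs)

/-- **Rows intersect** (the registry's "tightest of record" rule for pair rows): two certified windows at the
same `(H, N, L, r)` — e.g. a direct two-sided row and the box derived from a diagonal ceiling — give the window
`[max lo₁ lo₂, min hi₁ hi₂]`. [folklore] -/
theorem exists_pairCorrWindowCert_inter {L : ℕ} {r : Site 2} (c₁ c₂ : PairCorrWindowCert H N L r) :
    ∃ c : PairCorrWindowCert H N L r, c.lo = max c₁.lo c₂.lo ∧ c.hi = min c₁.hi c₂.hi :=
  ⟨⟨max c₁.lo c₂.lo, min c₁.hi c₂.hi, fun ψ h1 hgs =>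
    ⟨max_le (c₁.sound ψ h1 hgs).1 (c₂.sound ψ h1 hgs).1,
      le_min (c₁.sound ψ h1 hgs).2 (c₂.sound ψ h1 hgs).2⟩⟩, rfl, rfl⟩

/-! ## §2 The `S_d` word: `Σ_{r ∈ halfOpenBox 2 L} O_r = Δ† Δ`, so an `S_d` ceiling is a `pairFieldDensity` ceiling -/

/-- **Operator identity** `Σ_{r ∈ halfOpenBox 2 (m+1)} O_r = Δ_d† Δ_d` on the `(m+1) × (m+1)` torus (re-index the
displacement sum on the torus group; bilinearity). Scalapino (1995) §2 eq. (2.2)–(2.4). [folklore] -/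
theorem sum_halfOpenBox_pairCorrOp (m : ℕ) :
    ∑ r ∈ halfOpenBox 2 (m + 1), pairCorrOp (m + 1) r =
      (pairField dWaveFormFactor (m + 1))ᴴ * pairField dWaveFormFactor (m + 1) := by
  simp only [pairCorrOp]
  rw [sum_halfOpenBox_torusProj (m + 1) (fun r' : TorusSite 2 (m + 1) =>
      ∑ x : TorusSite 2 (m + 1), (localPair dWaveFormFactor (m + 1) x)ᴴ *
        localPair dWaveFormFactor (m + 1) (x + r')), sum_comm]
  have hre : ∀ x : TorusSite 2 (m + 1),
      ∑ r' : TorusSite 2 (m + 1), (localPair dWaveFormFactor (m + 1) x)ᴴ *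
          localPair dWaveFormFactor (m + 1) (x + r') =
        ∑ y : TorusSite 2 (m + 1), (localPair dWaveFormFactor (m + 1) x)ᴴ *
          localPair dWaveFormFactor (m + 1) y := fun x =>
    Fintype.sum_equiv (Equiv.addLeft x) _ _ fun _ => rfl
  simp only [hre, pairField, conjTranspose_sum, sum_mul, mul_sum]
  exact Finset.sum_comm

/-- **The `S_d` word on states:** `Σ_{r ∈ halfOpenBox} Re ⟨ψ, O_r ψ⟩ = Re ⟨ψ, Δ_d† Δ_d ψ⟩` for every vector.
Scalapino (1995) §2. [folklore] -/
theorem sum_halfOpenBox_re_expect_pairCorrOp (m : ℕ) (ψ : Fock (Orb (FermionTorus 2 (m + 1)))) :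
    ∑ r ∈ halfOpenBox 2 (m + 1), (star ψ ⬝ᵥ pairCorrOp (m + 1) r *ᵥ ψ).re =
      (star ψ ⬝ᵥ ((pairField dWaveFormFactor (m + 1))ᴴ * pairField dWaveFormFactor (m + 1)) *ᵥ ψ).re := by
  rw [← sum_halfOpenBox_pairCorrOp m, sum_mulVec, dotProduct_sum, Complex.re_sum]

/-- **An `S_d` ceiling is a pair-field-density ceiling:** a certified `Re ⟨ψ, Δ_d† Δ_d ψ⟩ ≤ S` on the normalised
sector ground states gives `pairFieldDensity (m+1) ψ ≤ S/(m+1)⁴` and `Σ_{r ∈ halfOpenBox} P̄_d(m+1, r; ψ) ≤ S/(m+1)²`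
there (the speedrun's S2b rows, `S_d = Σ_r P̄_d(r) = L² p_d`). HONEST FRAMING: first certified bounds; not a
superconductivity verdict; every number certified or labelled float. [cite: QinEtAl2020, §II eqs. (2)–(4)] -/
theorem pairFieldDensity_le_of_pairField_upper (m : ℕ) (S : ℝ)
    (hS : ∀ ψ : Fock (Orb (FermionTorus 2 (m + 1))), star ψ ⬝ᵥ ψ = 1 →
      IsGroundStateInSector (H (m + 1)) (N (m + 1)) 0 ψ →
        (star ψ ⬝ᵥ ((pairField dWaveFormFactor (m + 1))ᴴ * pairField dWaveFormFactor (m + 1)) *ᵥ ψ).re ≤ S)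
    (ψ : Fock (Orb (FermionTorus 2 (m + 1)))) (h1 : star ψ ⬝ᵥ ψ = 1)
    (hgs : IsGroundStateInSector (H (m + 1)) (N (m + 1)) 0 ψ) :
    pairFieldDensity (m + 1) ψ ≤ S / ((m + 1 : ℕ) : ℝ) ^ 4 ∧
      ∑ r ∈ halfOpenBox 2 (m + 1), avgPairCorr (m + 1) r ψ ≤ S / ((m + 1 : ℕ) : ℝ) ^ 2 := by
  have hL : (0 : ℝ) < ((m + 1 : ℕ) : ℝ) := by positivity
  have hL0 : ((m + 1 : ℕ) : ℝ) ≠ 0 := hL.ne'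
  have hp : pairFieldDensity (m + 1) ψ ≤ S / ((m + 1 : ℕ) : ℝ) ^ 4 := by
    show (expect ((pairField dWaveFormFactor (m + 1))ᴴ * pairField dWaveFormFactor (m + 1)) ψ).re /
        ((m + 1 : ℕ) : ℝ) ^ 4 ≤ _
    exact div_le_div_of_nonneg_right (hS ψ h1 hgs) (by positivity)
  refine ⟨hp, ?_⟩
  rw [sum_halfOpenBox_avgPairCorr]
  calc ((m + 1 : ℕ) : ℝ) ^ 2 * pairFieldDensity (m + 1) ψ
      ≤ ((m + 1 : ℕ) : ℝ) ^ 2 * (S / ((m + 1 : ℕ) : ℝ) ^ 4) := by gcongr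
    _ = S / ((m + 1 : ℕ) : ℝ) ^ 2 := by field_simp

end

end Summit.Ventures.CertifiedManyBodySolver.TorusPair
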